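import Literature.Probability.Percolation.KSTPeriodicWeak
import Literature.Probability.Percolation.KSTPeriodicDualMeasure
import Literature.Probability.Percolation.IsoradialProofs

/-!
# From the weak periodic RSW theorem to box-crossing bounds, part 3b: the upper sandwich

Support file for item `stmt-CriticalPhenomena-10267` (route `CardySelfRefinement`, crux
`CriticalPathRSW`, line finite-size-envelope, stub `stub_rswOfCertificates3`).

Transport of long-crossing bounds for the planar dual `μ* = μ ∘ dualConfig⁻¹` (class
`KSTPeriodic.Admissible k 1`) of a `kℤ²`-periodic lattice-carried measure `μ` (class
`Admissible k 0`) to UPPER bounds for the embedded crossing events `embRectCrossing` of Euclidean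
rectangles `w + [0, a n] × [0, n]`, `w ∈ ℂ`, for the isoradial drawing
`squareLatticeEmbedding.z = √2 · ℤ²` (Grimmett–Manolescu, PTRF 159 (2014), §2.3; Grimmett,
*Percolation* (1999), §11.7): on lattice configurations the embedded event is contained in the
crossing of the lattice rectangle `[i, I] × [j, J]` read off from `w`
(`mem_lrRect_of_mem_embRectCrossing`, first and last visits of columns), hence in a
`kℤ²`-translate of `LR([0, M'] × [0, n + k])`, `M' = ⌊an/2 - k⌋`, whose failure is a dual
top–bottom crossing (`lrCrossing_xor_dualTBCrossing_holds`) containing, after transposition, a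
`kℤ²`-translate of the dual long crossing `𝓒₁(ρ'' N₃, N₃)`, `ρ'' = ⌈16/a⌉`, `N₃ = ⌊an/8⌋`
(`embRectCrossing_upper`).
-/

noncomputable section

namespace Summit.CriticalPhenomena.CardyFormulaZ2.Cruxes.CriticalPathRSW.FiniteSizeEnvelope

open Set MeasureTheory Filter Topology
open Literature.Probability.LatticeModels Literature.Probability.Percolation

namespace RswCertSandwich

/-! ### A lattice rectangle around an embedded crossing -/

/-- **An embedded crossing contains a lattice crossing** (for lattice configurations). Let
`iL, iR, jB, jT` be integers such that every lattice column drawn in `{re ≤ 0}` has index `≤ iL`,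
every column drawn in `{A ≤ re}` has index `≥ iR`, `iL ≤ iR`, and every row drawn in the strip
`{0 ≤ im ≤ B}` has index in `[jB, jT]`. Then an open horizontal crossing of `[0, A] × [0, B]`
(`embRectCrossing`, drawing `v ↦ √2 v - w`) contains, between its last visit to the column `iL`
and its next visit to the column `iR`, an open left–right crossing of `[iL, iR] × [jB, jT]`. -/
theorem mem_lrRect_of_mem_embRectCrossing {ω : BondConfig (Site 2)} (hω : ω ⊆ (zdGraph 2).edgeSet)
    (w : ℂ) (A B : ℝ) (iL iR jB jT : ℤ)
    (hiL : ∀ t : ℤ, Real.sqrt 2 * t ≤ w.re → t ≤ iL)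
    (hiR : ∀ t : ℤ, w.re + A ≤ Real.sqrt 2 * t → iR ≤ t) (hLR : iL ≤ iR)
    (hjB : ∀ t : ℤ, w.im ≤ Real.sqrt 2 * t → jB ≤ t)
    (hjT : ∀ t : ℤ, Real.sqrt 2 * t ≤ w.im + B → t ≤ jT)
    (h : ω ∈ embRectCrossing (fun v => squareLatticeEmbedding.z v - w) A B) :
    ω ∈ KSTPeriodic.lrRect iL iR jB jT := by
  obtain ⟨x, hx, y, hy, hxy⟩ := h
  simp only [mem_setOf_eq, squareLatticeEmbedding_z_sub_re] at hx hy
  have hx' : x 0 ≤ iL := hiL _ (by linarith)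
  have hy' : iR ≤ y 0 := hiR _ (by linarith)
  -- rows of the strip
  have hrow : ∀ v ∈ {v : Site 2 | (squareLatticeEmbedding.z v - w).re ∈ Icc (-2) (A + 2) ∧
      (squareLatticeEmbedding.z v - w).im ∈ Icc 0 B}, jB ≤ v 1 ∧ v 1 ≤ jT := by
    intro v hv
    simp only [mem_setOf_eq, squareLatticeEmbedding_z_sub_im, mem_Icc] at hv
    exact ⟨hjB _ (by linarith [hv.2.1]), hjT _ (by linarith [hv.2.2])⟩
  -- first cut: up to the first visit of the column `iR`
  obtain ⟨z, hz, hxz⟩ := exists_openConnIn_column hω iR (by omega) hy' hxy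
  -- second cut: walking back from `z`, up to the first visit of the column `iL`
  rw [openConnIn_comm] at hxz
  obtain ⟨z', hz', hzz'⟩ := exists_openConnIn_column_ge hω iL (by omega) hx' hxz
  rw [openConnIn_comm] at hzz'
  have hsub : ({v : Site 2 | (squareLatticeEmbedding.z v - w).re ∈ Icc (-2) (A + 2) ∧
      (squareLatticeEmbedding.z v - w).im ∈ Icc 0 B} ∩ {v : Site 2 | v 0 ≤ iR}) ∩
        {v : Site 2 | iL ≤ v 0} ⊆ KSTPeriodic.rect iL iR jB jT := by
    rintro v ⟨⟨hv, hv1⟩, hv2⟩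
    obtain ⟨h1, h2⟩ := hrow v hv
    exact ⟨hv2, hv1, h1, h2⟩
  obtain ⟨hz'S, hzS, _⟩ := id hzz'
  exact ⟨z', ⟨hsub hz'S, hz'⟩, z, ⟨hsub hzS, hz⟩, openConnIn_mono hsub z' z hzz'⟩

/-! ### The upper bound -/

/-- **Upper box-crossing bound from dual long crossings.** Let `μ` be admissible (offset `0`)
and lattice-carried with an admissible dual `μ ∘ dualConfig⁻¹` (offset `1`) having long
crossings `μ*(𝓒₁(ρ'' N, N)) ≥ c₂` for all `N ≥ N₂` at the aspect ratio `ρ'' = ⌈16/a⌉`. Then for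
`a n ≥ 8 (N₂ + k + 2)`, `n ≥ k + 16/a` and every `w ∈ ℂ` the Euclidean rectangle
`w + [0, a n] × [0, n]` is crossed horizontally by `√2 ℤ²` with `μ`-probability `≤ 1 - c₂`: on
lattice configurations the embedded event lies in the crossing of `[i, I] × [j, J]`
(`I - i ≥ an/2`, `J - j ≤ n`), hence in a `kℤ²`-translate of `LR([0, M'] × [0, n + k])`,
`M' = ⌊an/2 - k⌋`, whose failure is a dual top–bottom crossing of `[0, M' - 1] × [-1, n + k]`
containing (after transposition) a translate of the dual long crossing of `R_1(ρ'' N₃, N₃)`,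
`N₃ = ⌊an/8⌋`. -/
theorem embRectCrossing_upper {k : ℕ} (hk : 1 ≤ k) {μ : Measure (BondConfig (Site 2))}
    [IsProbabilityMeasure μ] (hμ : KSTPeriodic.Admissible k 0 μ) (hL : KSTPeriodic.LatticeCarried μ)
    (hμ' : KSTPeriodic.Admissible k 1 (μ.map dualConfig))
    {a : ℝ} (ha : 0 < a) {c₂ : ℝ} {N₂ : ℕ}
    (hlong : ∀ N : ℕ, N₂ ≤ N →
      c₂ ≤ (μ.map dualConfig).real (KSTPeriodic.crossing 1 (⌈16 / a⌉₊ * N) N))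
    {n : ℕ} (hn : 8 * ((N₂ : ℝ) + k + 2) ≤ a * n) (hn' : (k : ℝ) + 16 / a ≤ n) (w : ℂ) :
    μ.real (embRectCrossing (fun v => squareLatticeEmbedding.z v - w) (a * n) n) ≤ 1 - c₂ := by
  obtain ⟨hs1, hs2⟩ := one_lt_sqrt_two_and_lt_two
  -- translation of rectangle crossings by `kℤ²`, solved form
  have hshift : ∀ {t : ℕ} {ν : Measure (BondConfig (Site 2))}, KSTPeriodic.Admissible k t ν →
      ∀ (v₀ v₁ : ℤ) {a b c d a' b' c' d' : ℤ}, a' = a + k * v₀ → b' = b + k * v₀ →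
        c' = c + k * v₁ → d' = d + k * v₁ →
        ν.real (KSTPeriodic.lrRect a' b' c' d') = ν.real (KSTPeriodic.lrRect a b c d) := by
    intro t ν hν v₀ v₁ a b c d a' b' c' d' ha hb hc hd
    subst ha hb hc hd
    simpa using KSTPeriodic.real_lrRect_shift hν ![v₀, v₁] a b c d
  -- inclusions valid on lattice configurations give inequalities of probabilities
  have hmono : ∀ {ν : Measure (BondConfig (Site 2))} [IsFiniteMeasure ν], KSTPeriodic.LatticeCarried ν →
      ∀ {A B : Set (BondConfig (Site 2))},
        (∀ ω : BondConfig (Site 2), ω ⊆ (zdGraph 2).edgeSet → ω ∈ A → ω ∈ B) → ν.real A ≤ ν.real B := by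
    intro ν _ hν A B h
    rw [measureReal_def, measureReal_def]
    exact ENNReal.toReal_mono (measure_ne_top ν B) (measure_mono_ae (hν.mono fun ω hω hA => h ω hω hA))
  -- the tree's `LR(m, n)` is `lrRect 0 m 0 n`
  have hlr : ∀ m l : ℕ, lrCrossing m l = KSTPeriodic.lrRect 0 m 0 l := by
    intro m l
    have hR : (↑(rectangle m l) : Set (Site 2)) = KSTPeriodic.rect 0 m 0 l := by
      ext x
      simp only [Finset.mem_coe, mem_rectangle_iff, KSTPeriodic.mem_rect]
    rw [lrCrossing, leftSide, rightSide, Finset.coe_filter, Finset.coe_filter, KSTPeriodic.lrRect, ← hR]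
    rfl
  -- the tree's dual crossing `TB*(m, l)` is the `dualConfig`-preimage of `tbRect 0 (m - 1) (-1) l`
  have htb : ∀ m l : ℕ, dualTBCrossing m l = dualConfig ⁻¹' KSTPeriodic.tbRect 0 ((m : ℤ) - 1) (-1) l := by
    intro m l
    have hR : (↑(dualRectangle m l) : Set (Site 2)) = KSTPeriodic.rect 0 ((m : ℤ) - 1) (-1) l := by
      ext x
      simp only [Finset.mem_coe, mem_dualRectangle_iff, KSTPeriodic.mem_rect]
    have hT : (↑(dualTopSide m l) : Set (Site 2)) =
        {x | x ∈ KSTPeriodic.rect 0 ((m : ℤ) - 1) (-1) l ∧ x 1 = (l : ℤ)} := by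
      ext x
      simp only [Finset.mem_coe, dualTopSide, Finset.mem_filter, mem_dualRectangle_iff,
        KSTPeriodic.mem_rect, Set.mem_setOf_eq]
    have hB : (↑(dualBottomSide m l) : Set (Site 2)) =
        {x | x ∈ KSTPeriodic.rect 0 ((m : ℤ) - 1) (-1) l ∧ x 1 = -1} := by
      ext x
      simp only [Finset.mem_coe, dualBottomSide, Finset.mem_filter, mem_dualRectangle_iff,
        KSTPeriodic.mem_rect, Set.mem_setOf_eq]
    rw [dualTBCrossing, hR, hT, hB, KSTPeriodic.tbRect, KSTPeriodic.openCrossing_comm]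
  set s := Real.sqrt 2 with hs_def
  have hs0 : 0 < s := by linarith
  have hk' : (1 : ℝ) ≤ k := by exact_mod_cast hk
  have ha16 : 0 < 16 / a := by positivity
  have hn0 : (0 : ℝ) ≤ n := Nat.cast_nonneg n
  have han : 0 ≤ a * n := mul_nonneg ha.le hn0
  haveI : IsProbabilityMeasure (μ.map dualConfig) := KSTPeriodic.isProbabilityMeasure_map_dualConfig μ
  -- the lattice rectangle read off from `w`
  set i : ℤ := ⌊w.re / s⌋ with hi
  set I : ℤ := ⌈(w.re + a * n) / s⌉ with hI
  set j : ℤ := ⌈w.im / s⌉ with hj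
  set J : ℤ := ⌊(w.im + n) / s⌋ with hJ
  have hiL : ∀ t : ℤ, s * t ≤ w.re → t ≤ i := fun t ht => by
    rw [hi, Int.le_floor, le_div_iff₀ hs0]; linarith
  have hiR : ∀ t : ℤ, w.re + a * n ≤ s * t → I ≤ t := fun t ht => by
    rw [hI, Int.ceil_le, div_le_iff₀ hs0]; linarith
  have hjB : ∀ t : ℤ, w.im ≤ s * t → j ≤ t := fun t ht => by
    rw [hj, Int.ceil_le, div_le_iff₀ hs0]; linarith
  have hjT : ∀ t : ℤ, s * t ≤ w.im + n → t ≤ J := fun t ht => by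
    rw [hJ, Int.le_floor, le_div_iff₀ hs0]; linarith
  have eL1 : s * i ≤ w.re := by
    have := Int.floor_le (w.re / s); rw [le_div_iff₀ hs0] at this; linarith
  have eR1 : w.re + a * n ≤ s * I := by
    have := Int.le_ceil ((w.re + a * n) / s); rw [div_le_iff₀ hs0] at this; linarith
  have eB1 : w.im ≤ s * j := by
    have := Int.le_ceil (w.im / s); rw [div_le_iff₀ hs0] at this; linarith
  have eT1 : s * J ≤ w.im + n := by
    have := Int.floor_le ((w.im + n) / s); rw [le_div_iff₀ hs0] at this; linarith
  have hiI : i ≤ I := by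
    have : (i : ℝ) ≤ I := le_of_mul_le_mul_left (by linarith : s * i ≤ s * I) hs0
    exact_mod_cast this
  -- the scales
  set M' : ℕ := ⌊a * n / 2 - k⌋₊ with hM'
  set N₃ : ℕ := ⌊a * n / 8⌋₊ with hN₃
  set ρ'' : ℕ := ⌈16 / a⌉₊ with hρ''
  have hM'1 : (M' : ℝ) ≤ a * n / 2 - k := Nat.floor_le (by linarith)
  have hM'2 : a * n / 2 - k < M' + 1 := Nat.lt_floor_add_one _
  have hN₃1 : (N₃ : ℝ) ≤ a * n / 8 := Nat.floor_le (by positivity)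
  have hN₃2 : a * n / 8 < N₃ + 1 := Nat.lt_floor_add_one _
  have hρ''1 : 16 / a ≤ ρ'' := Nat.le_ceil _
  have hN₂ : N₂ ≤ N₃ := by
    have : (N₂ : ℝ) < N₃ := by linarith
    exact_mod_cast this.le
  -- multiples of `k`
  set v₀ : ℤ := i / k + 1 with hv₀
  set u : ℤ := j / k with hu
  set u₁ : ℤ := ((N₃ : ℤ) + 1) / k + 1 with hu₁
  have hk0 : (0 : ℤ) < k := by exact_mod_cast hk
  have hwin : ∀ x : ℤ, x < (k : ℤ) * (x / k + 1) ∧ (k : ℤ) * (x / k + 1) ≤ x + k := fun x => by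
    have h1 := Int.lt_mul_ediv_self_add (x := x) hk0
    have h2 := Int.mul_ediv_self_le (x := x) hk0.ne'
    constructor <;> linarith [mul_add (k : ℤ) (x / k) 1]
  have hkv₀ : i < (k : ℤ) * v₀ ∧ (k : ℤ) * v₀ ≤ i + k := hwin i
  have hku : j < (k : ℤ) * u + k ∧ (k : ℤ) * u ≤ j :=
    ⟨Int.lt_mul_ediv_self_add hk0, Int.mul_ediv_self_le hk0.ne'⟩
  have hku₁ : (N₃ : ℤ) + 1 < (k : ℤ) * u₁ ∧ (k : ℤ) * u₁ ≤ (N₃ : ℤ) + 1 + k := hwin ((N₃ : ℤ) + 1)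
  -- integer consequences
  have hG1 : (k : ℤ) * v₀ + M' ≤ I := by
    have h0 : (0 : ℝ) ≤ (I : ℝ) - i := by
      have : (i : ℝ) ≤ I := by exact_mod_cast hiI
      linarith
    have h1 : a * n ≤ s * ((I : ℝ) - i) := by
      have : s * ((I : ℝ) - i) = s * I - s * i := by ring
      linarith
    have h2 : a * n / 2 ≤ (I : ℝ) - i := by
      have := mul_le_mul_of_nonneg_right hs2.le h0
      linarith
    have h3 : (((k : ℤ) * v₀ + (M' : ℤ) : ℤ) : ℝ) ≤ (I : ℝ) := by
      have h4 : (((k : ℤ) * v₀ : ℤ) : ℝ) ≤ ((i + k : ℤ) : ℝ) := by exact_mod_cast hkv₀.2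
      push_cast at h4 ⊢
      linarith
    exact_mod_cast h3
  have hG2 : J ≤ (k : ℤ) * u + ((n + k : ℕ) : ℤ) := by
    have h1 : s * ((J : ℝ) - j) ≤ n := by
      have : s * ((J : ℝ) - j) = s * J - s * j := by ring
      linarith
    have h2 : (J : ℝ) - j ≤ n := by
      by_cases h0 : (0 : ℝ) ≤ (J : ℝ) - j
      · have := mul_le_mul_of_nonneg_right hs1.le h0
        linarith
      · linarith
    have h3 : ((J : ℤ) : ℝ) < (((k : ℤ) * u + ((n + k : ℕ) : ℤ) : ℤ) : ℝ) := by
      have h4 : ((j : ℤ) : ℝ) < (((k : ℤ) * u + k : ℤ) : ℝ) := by exact_mod_cast hku.1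
      push_cast at h4 ⊢
      linarith
    have h5 : J < (k : ℤ) * u + ((n + k : ℕ) : ℤ) := by exact_mod_cast h3
    omega
  have hG3 : ((n + k : ℕ) : ℤ) ≤ (ρ'' : ℤ) * N₃ := by
    have h1 : 16 / a * (a * n / 8 - 1) ≤ (ρ'' : ℝ) * N₃ := by
      have h2 : 16 / a * (a * n / 8 - 1) ≤ 16 / a * N₃ :=
        mul_le_mul_of_nonneg_left (by linarith) ha16.le
      have h3 : 16 / a * (N₃ : ℝ) ≤ ρ'' * N₃ := mul_le_mul_of_nonneg_right hρ''1 (Nat.cast_nonneg _)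
      linarith
    have h4 : 16 / a * (a * n / 8 - 1) = 2 * n - 16 / a := by field_simp; ring
    have h5 : (((n + k : ℕ) : ℤ) : ℝ) ≤ (((ρ'' : ℤ) * (N₃ : ℤ) : ℤ) : ℝ) := by push_cast; linarith
    exact_mod_cast h5
  have hG4 : (N₃ : ℤ) + (k : ℤ) * u₁ ≤ (M' : ℤ) - 1 := by
    have h1 : (((N₃ : ℤ) + (k : ℤ) * u₁ : ℤ) : ℝ) < (((M' : ℤ) - 1 + 1 : ℤ) : ℝ) := by
      have h2 : ((((k : ℤ) * u₁ : ℤ)) : ℝ) ≤ (((N₃ : ℤ) + 1 + k : ℤ) : ℝ) := by exact_mod_cast hku₁.2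
      push_cast at h2 ⊢
      linarith
    have h3 : (N₃ : ℤ) + (k : ℤ) * u₁ < (M' : ℤ) - 1 + 1 := by exact_mod_cast h1
    omega
  -- the primal part: the embedded crossing forces a lattice crossing of `[0, M'] × [0, n + k]`
  have hprimal : μ.real (embRectCrossing (fun v => squareLatticeEmbedding.z v - w) (a * n) n) ≤
      μ.real (KSTPeriodic.lrRect 0 M' 0 ((n + k : ℕ) : ℤ)) := by
    calc μ.real (embRectCrossing (fun v => squareLatticeEmbedding.z v - w) (a * n) n)
        ≤ μ.real (KSTPeriodic.lrRect i I j J) :=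
          hmono hL fun ω hω h =>
            mem_lrRect_of_mem_embRectCrossing hω w (a * n) n i I j J hiL hiR hiI hjB hjT h
      _ ≤ μ.real (KSTPeriodic.lrRect ((k : ℤ) * v₀) ((k : ℤ) * v₀ + M') ((k : ℤ) * u)
            ((k : ℤ) * u + ((n + k : ℕ) : ℤ))) :=
          hmono hL fun ω hω h =>
            KSTPeriodic.lrRect_subset_lrRect hω (by linarith) (by linarith) hG1 (by linarith) hG2 h
      _ = μ.real (KSTPeriodic.lrRect 0 M' 0 ((n + k : ℕ) : ℤ)) :=
          hshift hμ v₀ u (by ring) (by ring) (by ring) (by ring)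
  -- planar duality: a crossing of `[0, M'] × [0, n + k]` excludes the dual crossing
  have hduality : μ.real (KSTPeriodic.lrRect 0 M' 0 ((n + k : ℕ) : ℤ)) +
      (μ.map dualConfig).real (KSTPeriodic.lrRect (-1) ((n + k : ℕ) : ℤ) 0 ((M' : ℤ) - 1)) ≤ 1 := by
    rw [← hlr, ← KSTPeriodic.real_tbRect_eq_real_lrRect hμ',
      map_measureReal_apply measurable_dualConfig (KSTPeriodic.measurableSet_tbRect _ _ _ _),
      ← htb]
    have h1 : μ.real (dualTBCrossing M' (n + k)) ≤ μ.real (lrCrossing M' (n + k))ᶜ :=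
      hmono hL fun ω hω h => by
        rcases lrCrossing_xor_dualTBCrossing_holds M' (n + k) hω with ⟨-, h2⟩ | ⟨-, h2⟩
        · exact absurd h h2
        · exact h2
    rw [probReal_compl_eq_one_sub (s := lrCrossing M' (n + k))
      (measurableSet_openCrossing_of_countable _ _ _)] at h1
    linarith
  -- the dual part: the dual crossing contains a translate of a dual long crossing
  have hdual : c₂ ≤ (μ.map dualConfig).real (KSTPeriodic.lrRect (-1) ((n + k : ℕ) : ℤ) 0 ((M' : ℤ) - 1)) := by
    calc c₂ ≤ (μ.map dualConfig).real (KSTPeriodic.crossing 1 (ρ'' * N₃) N₃) := hlong N₃ hN₂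
      _ = (μ.map dualConfig).real (KSTPeriodic.lrRect (-((ρ'' : ℤ) * N₃) - 1) ((ρ'' : ℤ) * N₃)
            (-(N₃ : ℤ) - 1 + k * u₁) (N₃ + k * u₁)) := by
          rw [KSTPeriodic.crossing]
          exact (hshift hμ' 0 u₁ (by push_cast; ring) (by push_cast; ring)
            (by push_cast; ring) rfl).symm
      _ ≤ (μ.map dualConfig).real (KSTPeriodic.lrRect (-1) ((n + k : ℕ) : ℤ) 0 ((M' : ℤ) - 1)) :=
          hmono (KSTPeriodic.latticeCarried_map_dualConfig μ) fun ω hω h =>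
            KSTPeriodic.lrRect_subset_lrRect hω (by linarith) (by linarith) hG3 (by linarith) hG4 h
  linarith

end RswCertSandwich

/-- **Headline of this support file** (registered sub-stub `stub_rswOfCertificates3_sandwichB`
of `stub_rswOfCertificates3`): upper box-crossing bounds for `√2 ℤ²` from dual long crossings
of an admissible lattice-carried measure with admissible dual. -/
theorem stub_rswOfCertificates3_sandwichB :
    ∀ (k : ℕ), 1 ≤ k → ∀ (μ : Measure (BondConfig (Site 2))) [IsProbabilityMeasure μ],
      KSTPeriodic.Admissible k 0 μ → KSTPeriodic.LatticeCarried μ →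
      KSTPeriodic.Admissible k 1 (μ.map dualConfig) →
      ∀ (a : ℝ), 0 < a → ∀ (c₂ : ℝ) (N₂ : ℕ),
        (∀ N : ℕ, N₂ ≤ N → c₂ ≤ (μ.map dualConfig).real (KSTPeriodic.crossing 1 (⌈16 / a⌉₊ * N) N)) →
        ∀ n : ℕ, 8 * ((N₂ : ℝ) + k + 2) ≤ a * n → (k : ℝ) + 16 / a ≤ n → ∀ w : ℂ,
          μ.real (embRectCrossing (fun v => squareLatticeEmbedding.z v - w) (a * n) n) ≤ 1 - c₂ :=
  fun _ hk _ _ hμ hL hμ' _ ha _ _ hlong _ hn hn' w =>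
    RswCertSandwich.embRectCrossing_upper hk hμ hL hμ' ha hlong hn hn' w

end Summit.CriticalPhenomena.CardyFormulaZ2.Cruxes.CriticalPathRSW.FiniteSizeEnvelope

end
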